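import Literature.NumberTheory.DiophantineGeometry.ConductorExponentLeFiveProofs
import Literature.NumberTheory.DiophantineGeometry.TateAlgorithmTranslationsProofs
import HarnessLib

/-!
# Tate's algorithm at `p = 3`: exact valuations of `c₄, c₆, Δ` at the exits I₀*, Iₙ*, IV*

`Proofs` file (theorems only; no definition, no named fact) in topic
`NumberTheory/DiophantineGeometry`, second file of the kernel discharge of
`WeierstrassCurve.conductorExponent_eq_tableConductorExponentThree` (cell `b2b-bsdres`, team
n1011, ROW T-PAP3), continuing `TateAlgorithmThreeExitValuesProofs` (exits II, III, IV) with the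
exits of Steps 6, 7, 8 of Silverman, *ATAEC* IV.9.4 over a discrete valuation ring `R` with
`2 ∈ Rˣ` and `3` a uniformiser:

* `exitIstar_values` — on a Step-6 normalised model (`π ∣ a₁, a₂`, `π² ∣ a₃, a₄`, `π³ ∣ a₆`):
  three distinct roots of the cubic (type I₀*) give `ord Δ = 6` and `(ord c₄, ord c₆) = (2, 3)`
  or `ord c₄ = 3`, `3⁶ ∣ c₆` (Rizzo's rows `(2,3,6)`, `(3,≥6,6)`); a double root (type Iₙ*,
  `n ≥ 1`) gives `π⁷ ∣ Δ` and `(ord c₄, ord c₆) = (2, 3)` (rows `(2,3,6+n)`);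
* `exitIVstar_values` — on a Step-8 normalised model whose quadratic has distinct roots (type
  IV*): with `b₂ = 9B₂`, `b₄ = 27B₄`, `b₆ = 81B₆` the invariants are those of exit II shifted by
  `(2, 3, 6)`: rows `(≥4,6,9)`, `(4,7,9)`, `(4,6,10)`, `(≥5,7,11)`, with the SAME residue datum
  (`TateAlgorithm.nine_dvd_sq_add_two_sub_iff`) behind the special condition on `(≥4,6,9)`.

The tests of Steps 6–8 are decoded on the `uniformizer R`-parametrisation of the model
(`cubicStep6_eq`, `quadraticStep8_eq`, `step67_of_isUnit_two`); the invariants are computed on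
the `3`-parametrisation, where the identities are literally those of the previous file.

## References

* J. H. Silverman, *Advanced Topics in the Arithmetic of Elliptic Curves*, GTM 151 (1994), IV.9.4
  Steps 6–8 and Table 4.1. [Silverman1994]
* I. Papadopoulos, J. Number Theory 44 (1993) 119–152, §2 and Table III (`p = 3`). [Papadopoulos1993]
* O. G. Rizzo, Compositio Math. 136 (2003) 1–23, Table II (p. 4). [Rizzo2003]
-/

open Polynomial IsLocalRing
open IsDiscreteValuationRing hiding maximalIdeal

namespace Literature.NumberTheory.DiophantineGeometry

namespace TateAlgorithm

variable {R : Type*} [CommRing R] [IsDomain R] [IsDiscreteValuationRing R]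

/-! ### `3` versus the chosen uniformiser -/

omit [IsDomain R] [IsDiscreteValuationRing R] in
/-- Small units when `2 ∈ Rˣ`: `8 = 2³`. [folklore] -/
private theorem isUnit_eight' (h2 : IsUnit (2 : R)) : IsUnit (8 : R) := by
  have : (8 : R) = 2 ^ 3 := by norm_num
  rw [this]; exact h2.pow 3

/-- When `3` is a uniformiser: `3 = ϖ μ` for the chosen uniformiser `ϖ` and a unit `μ`.
[folklore] -/
private theorem exists_three_eq_uniformizer_mul (h3 : Irreducible (3 : R)) :
    ∃ μ : R, IsUnit μ ∧ (3 : R) = uniformizer R * μ := by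
  obtain ⟨μu, hμu⟩ := associated_of_irreducible R irreducible_uniformizer h3
  exact ⟨μu, Units.isUnit μu, hμu.symm⟩

/-- When `3` is a uniformiser, `𝔪 ^ n`-membership is divisibility by `3 ^ n`. [folklore] -/
private theorem mem_pow_iff_three_pow_dvd (h3 : Irreducible (3 : R)) (x : R) (n : ℕ) :
    x ∈ maximalIdeal R ^ n ↔ (3 : R) ^ n ∣ x :=
  mem_maximalIdeal_pow_iff_dvd_of_irreducible h3 x n

/-- When `3` is a uniformiser, `𝔪`-membership is divisibility by `3`. [folklore] -/
private theorem mem_iff_three_dvd (h3 : Irreducible (3 : R)) (x : R) :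
    x ∈ maximalIdeal R ↔ (3 : R) ∣ x :=
  mem_maximalIdeal_iff_dvd_of_irreducible h3 x

/-- When `3` is a uniformiser the residue field has characteristic `3`: `(27 : k) = 0`.
[folklore] -/
private theorem residue_twentyseven_eq_zero (h3 : Irreducible (3 : R)) : (27 : ResidueField R) = 0 := by
  rw [← map_ofNat (residue R) 27]
  exact residue_eq_zero_of_dvd h3 ⟨9, by norm_num⟩

/-- When `3` is a uniformiser the residue field has characteristic `3`: `(3 : k) = 0`.
[folklore] -/
private theorem residue_three_eq_zero (h3 : Irreducible (3 : R)) : (3 : ResidueField R) = 0 := by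
  rw [← map_ofNat (residue R) 3]
  exact residue_eq_zero_of_dvd h3 (dvd_refl 3)

/-! ### Steps 6 and 7: types I₀* and Iₙ* -/

/-- On a Step-6 normalised model at `p = 3`, if `a₂,₁ = a₂/π` is a unit then
`(ord c₄, ord c₆) = (2, 3)`: `c₄ = π²(B₂² − 24B₄)`, `c₆ = π³(−B₂³ + 36B₂B₄ − 216B₆)` with
`B₂ = 4a₂,₁ + π a₁,₁² ∈ Rˣ` and `3 ∣ 24, 36, 216`. [cite: Silverman1994, IV.9.4 Steps 6–7] -/
theorem addVal_c₄_c₆_of_step6_of_isUnit (h2 : IsUnit (2 : R)) (h3 : Irreducible (3 : R))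
    (W : WeierstrassCurve R) {α p γ q r : R} (hα : W.a₁ = uniformizer R * α)
    (hp : W.a₂ = uniformizer R * p) (hγ : W.a₃ = uniformizer R ^ 2 * γ)
    (hq : W.a₄ = uniformizer R ^ 2 * q) (hr : W.a₆ = uniformizer R ^ 3 * r) (hpu : IsUnit p) :
    (addVal R W.c₄).toNat = 2 ∧ (addVal R W.c₆).toNat = 3 := by
  set ϖ := uniformizer R with hϖdef
  have hϖ : Irreducible ϖ := irreducible_uniformizer
  obtain ⟨μ, hμ, h3'⟩ := exists_three_eq_uniformizer_mul h3
  have h4 : IsUnit (4 : R) := isUnit_four h2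
  have hb₂ := b₂_step6 W ϖ hα hp
  have hb₄ := b₄_step6 W ϖ hα hγ hq
  have hb₆ := b₆_step6 W ϖ hγ hr
  have hc₄ := c₄_of_b W ϖ hb₂ hb₄
  have hc₆ := c₆_of_b W ϖ hb₂ hb₄ hb₆
  have hB₂ : IsUnit (4 * p + ϖ * α ^ 2) := isUnit_add_mul_of_isUnit hϖ (h4.mul hpu) _
  have h24 : (24 : R) = 8 * (ϖ * μ) := by rw [← h3']; norm_num
  have h36 : (36 : R) = 4 * (ϖ * μ) ^ 2 := by rw [← h3']; norm_num
  have h216 : (216 : R) = 8 * (ϖ * μ) ^ 3 := by rw [← h3']; norm_num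
  constructor
  · have e : 1 * W.c₄ = ϖ ^ 2 * ((4 * p + ϖ * α ^ 2) ^ 2 +
        ϖ * (-(8 * μ * (2 * q + ϖ * α * γ)))) := by
      rw [hc₄, h24]; ring
    exact addVal_toNat_eq_of_eq_add hϖ isUnit_one (hB₂.pow 2) e
  · have e : 1 * W.c₆ = ϖ ^ 3 * (-(4 * p + ϖ * α ^ 2) ^ 3 +
        ϖ * (4 * ϖ * μ ^ 2 * (4 * p + ϖ * α ^ 2) * (2 * q + ϖ * α * γ) -
          8 * ϖ ^ 2 * μ ^ 3 * (4 * r + ϖ * γ ^ 2))) := by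
      rw [hc₆, h36, h216]; ring
    exact addVal_toNat_eq_of_eq_add hϖ isUnit_one (hB₂.pow 3).neg e

/-- **Exits I₀* and Iₙ* (Steps 6–7) at `p = 3`: the exact invariants.** On a Step-6 normalised
model (`π ∣ a₁, a₂`, `π² ∣ a₃, a₄`, `π³ ∣ a₆`; Silverman *ATAEC* IV.9.4):
(a) if the cubic `P = X³ + a₂,₁X² + a₄,₂X + a₆,₃` has three distinct roots (type I₀*, `m = 5`)
then `ord Δ = 6` and either `(ord c₄, ord c₆) = (2, 3)` (`a₂,₁ ≠ 0`; row `(2, 3, 6)`) or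
`ord c₄ = 3`, `3⁶ ∣ c₆` (`a₂,₁ = 0`, then `a₄,₂ ≠ 0` in characteristic `3`; row `(3, ≥6, 6)`),
`f = 2` in both cases;
(b) if `P` has exactly two distinct roots (type Iₙ*, `n ≥ 1`, `m = n + 5`) then `π⁷ ∣ Δ`,
`c₄ = π²·unit`, and `(ord c₄, ord c₆) = (2, 3)` (the double root forces `a₂,₁ ≠ 0` in
characteristic `3`): rows `(2, 3, 6 + n)`, `f = 2`, with `n = ord Δ − 6` (`istarIndex_add_six`).
[cite: Silverman1994, IV.9.4 Steps 6–7 and Table 4.1] [cite: Rizzo2003, Table II (p. 4), rows I₀*, Iₙ*] -/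
theorem exitIstar_values (h2 : IsUnit (2 : R)) (h3 : Irreducible (3 : R)) (W : WeierstrassCurve R)
    (ha₁ : W.a₁ ∈ maximalIdeal R) (ha₂ : W.a₂ ∈ maximalIdeal R) (ha₃ : W.a₃ ∈ maximalIdeal R ^ 2)
    (ha₄ : W.a₄ ∈ maximalIdeal R ^ 2) (ha₆ : W.a₆ ∈ maximalIdeal R ^ 3) :
    (distinctRootCount (cubicStep6 W) = 3 →
      (addVal R W.Δ).toNat = 6 ∧
      (((addVal R W.c₄).toNat = 2 ∧ (addVal R W.c₆).toNat = 3) ∨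
        ((addVal R W.c₄).toNat = 3 ∧ (3 : R) ^ 6 ∣ W.c₆))) ∧
    (distinctRootCount (cubicStep6 W) = 2 →
      uniformizer R ^ 7 ∣ W.Δ ∧ (∃ u, IsUnit u ∧ W.c₄ = uniformizer R ^ 2 * u) ∧
      (addVal R W.c₄).toNat = 2 ∧ (addVal R W.c₆).toNat = 3) := by
  set ϖ := uniformizer R with hϖdef
  have hϖ : Irreducible ϖ := irreducible_uniformizer
  obtain ⟨μ, hμ, h3'⟩ := exists_three_eq_uniformizer_mul h3
  have ha₁' := (mem_maximalIdeal_iff_dvd_of_irreducible hϖ _).mp ha₁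
  have ha₂' := (mem_maximalIdeal_iff_dvd_of_irreducible hϖ _).mp ha₂
  have ha₃' := (mem_maximalIdeal_pow_iff_dvd_of_irreducible hϖ _ _).mp ha₃
  have ha₄' := (mem_maximalIdeal_pow_iff_dvd_of_irreducible hϖ _ _).mp ha₄
  have ha₆' := (mem_maximalIdeal_pow_iff_dvd_of_irreducible hϖ _ _).mp ha₆
  have h67 := step67_of_isUnit_two h2 W ha₁' ha₂' ha₃' ha₄' ha₆'
  obtain ⟨α, hα⟩ := ha₁'
  obtain ⟨p, hp⟩ := ha₂'
  obtain ⟨γ, hγ⟩ := ha₃'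
  obtain ⟨q, hq⟩ := ha₄'
  obtain ⟨r, hr⟩ := ha₆'
  have h4 : IsUnit (4 : R) := isUnit_four h2
  have h8 : IsUnit (8 : R) := isUnit_eight' h2
  have hP : cubicStep6 W = X ^ 3 + C (residue R p) * X ^ 2 + C (residue R q) * X +
      C (residue R r) := cubicStep6_eq hp hq hr
  have hk3 : (3 : ResidueField R) = 0 := residue_three_eq_zero h3
  have hk27 : (27 : ResidueField R) = 0 := residue_twentyseven_eq_zero h3
  have hvals := addVal_c₄_c₆_of_step6_of_isUnit h2 h3 W hα hp hγ hq hr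
  constructor
  · intro h3r
    refine ⟨h67.1 h3r, ?_⟩
    by_cases hpu : IsUnit p
    · exact Or.inl (hvals hpu)
    · right
      obtain ⟨p', hp'⟩ := (not_isUnit_iff_dvd hϖ _).mp hpu
      have hp0 : residue R p = 0 := residue_eq_zero_of_dvd hϖ ⟨p', hp'⟩
      rw [hP, distinctRootCount_cubic_eq_three_iff] at h3r
      have hqu : IsUnit q := by
        rw [isUnit_iff_residue_ne_zero]
        intro hq0
        apply h3r
        rw [hp0, hq0, hk27]; ring
      have hB₄ : IsUnit (2 * q + ϖ * α * γ) := by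
        have := isUnit_add_mul_of_isUnit hϖ (h2.mul hqu) (α * γ)
        rwa [← mul_assoc] at this
      have hb₂ := b₂_step6 W ϖ hα hp
      have hb₄ := b₄_step6 W ϖ hα hγ hq
      have hb₆ := b₆_step6 W ϖ hγ hr
      have hc₄ := c₄_of_b W ϖ hb₂ hb₄
      have hc₆ := c₆_of_b W ϖ hb₂ hb₄ hb₆
      have h24 : (24 : R) = 8 * (ϖ * μ) := by rw [← h3']; norm_num
      have h36 : (36 : R) = 4 * (ϖ * μ) ^ 2 := by rw [← h3']; norm_num
      have h216 : (216 : R) = 8 * (ϖ * μ) ^ 3 := by rw [← h3']; norm_num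
      constructor
      · have e : 1 * W.c₄ = ϖ ^ 3 * (-(8 * μ * (2 * q + ϖ * α * γ)) +
            ϖ * (4 * p' + α ^ 2) ^ 2) := by
          rw [hc₄, h24, hp']; ring
        exact addVal_toNat_eq_of_eq_add hϖ isUnit_one ((h8.mul hμ).mul hB₄).neg e
      · have e : W.c₆ = ϖ ^ 6 * (-(4 * p' + α ^ 2) ^ 3 +
            4 * μ ^ 2 * (4 * p' + α ^ 2) * (2 * q + ϖ * α * γ) - 8 * μ ^ 3 * (4 * r + ϖ * γ ^ 2)) := by
          rw [hc₆, h36, h216, hp']; ring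
        exact (mem_pow_iff_three_pow_dvd h3 _ 6).mp
          ((mem_maximalIdeal_pow_iff_dvd_of_irreducible hϖ _ 6).mpr ⟨_, e⟩)
  · intro h2r
    have h3r : distinctRootCount (cubicStep6 W) ≠ 3 := by rw [h2r]; decide
    obtain ⟨hΔ7, hc₄u⟩ := h67.2 h3r
    refine ⟨hΔ7, hc₄u h2r, ?_⟩
    have hdisc : residue R p ^ 2 * residue R q ^ 2 - 4 * residue R q ^ 3 -
        4 * residue R p ^ 3 * residue R r - 27 * residue R r ^ 2 +
        18 * residue R p * residue R q * residue R r = 0 := by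
      by_contra hne
      exact h3r (by rw [hP, distinctRootCount_cubic_eq_three_iff]; exact hne)
    rw [hP, distinctRootCount_cubic_eq_two_iff _ _ _ hdisc, hk3, zero_mul, sub_zero] at h2r
    have hpu : IsUnit p := by
      rw [isUnit_iff_residue_ne_zero]
      intro hp0; apply h2r; rw [hp0]; ring
    exact hvals hpu


/-! ### Step 8: type IV* -/

section IdentitiesStar

omit [IsDomain R] [IsDiscreteValuationRing R]

/-- `c₄ = 3⁴(B₂² − 8B₄)` when `b₂ = 3²B₂`, `b₄ = 3³B₄`. [cite: Silverman1994, IV.9.4 (the quantities b₂, b₄, b₆, c₄, c₆, Δ of the model; AEC III.1)] -/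
theorem c₄_of_b_nine (W : WeierstrassCurve R) {B₂ B₄ : R} (hb₂ : W.b₂ = 3 ^ 2 * B₂)
    (hb₄ : W.b₄ = 3 ^ 3 * B₄) : W.c₄ = 3 ^ 4 * (B₂ ^ 2 - 8 * B₄) := by
  simp only [WeierstrassCurve.c₄]; rw [hb₂, hb₄]; ring

/-- `c₆ = 3⁶(−B₂³ + 12B₂B₄ − 24B₆)` when `b₂ = 3²B₂`, `b₄ = 3³B₄`, `b₆ = 3⁴B₆`. [cite: Silverman1994, IV.9.4 (the quantities b₂, b₄, b₆, c₄, c₆, Δ of the model; AEC III.1)] -/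
theorem c₆_of_b_nine (W : WeierstrassCurve R) {B₂ B₄ B₆ : R} (hb₂ : W.b₂ = 3 ^ 2 * B₂)
    (hb₄ : W.b₄ = 3 ^ 3 * B₄) (hb₆ : W.b₆ = 3 ^ 4 * B₆) :
    W.c₆ = 3 ^ 6 * (-B₂ ^ 3 + 12 * B₂ * B₄ - 24 * B₆) := by
  simp only [WeierstrassCurve.c₆]; rw [hb₂, hb₄, hb₆]; ring

/-- `4Δ = 3⁹(−32B₄³ + 3(−B₂³B₆ + B₂²B₄² − 12B₆² + 12B₂B₄B₆))` when `b₂ = 3²B₂`, `b₄ = 3³B₄`,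
`b₆ = 3⁴B₆` — the exit-II polynomial shifted by `3⁶`. [folklore] -/
private theorem four_Δ_of_b_nine (W : WeierstrassCurve R) {B₂ B₄ B₆ : R} (hb₂ : W.b₂ = 3 ^ 2 * B₂)
    (hb₄ : W.b₄ = 3 ^ 3 * B₄) (hb₆ : W.b₆ = 3 ^ 4 * B₆) :
    4 * W.Δ = 3 ^ 9 * (-32 * B₄ ^ 3 +
      3 * (-B₂ ^ 3 * B₆ + B₂ ^ 2 * B₄ ^ 2 - 12 * B₆ ^ 2 + 12 * B₂ * B₄ * B₆)) := by
  rw [four_mul_Δ_eq, hb₂, hb₄, hb₆]; ring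

end IdentitiesStar

/-- **Exit IV* (Step 8) at `p = 3`: the exact invariants.** On a Step-8 normalised model
(`π ∣ a₁`, `π² ∣ a₂, a₃`, `π³ ∣ a₄`, `π⁴ ∣ a₆`; Silverman *ATAEC* IV.9.4) whose quadratic
`Y² + a₃,₂Y − a₆,₄` has distinct roots (type IV*, `m = 7`), write `b₂ = 3²B₂`, `b₄ = 3³B₄`,
`b₆ = 3⁴B₆`; then `B₆ ∈ Rˣ` and exactly one of: `B₂, B₄ ∈ Rˣ`: `3⁴ ∣ c₄`, `ord c₆ = 6`,
`ord Δ = 9` (row `(≥4, 6, 9)`, `f = 3`); `3 ∣ B₂`, `B₄ ∈ Rˣ`: `(4, 7, 9)` (`f = 3`);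
`B₂ ∈ Rˣ`, `3 ∣ B₄`: `(4, 6, 10)` (`f = 4`); `3 ∣ B₂, B₄`: `3⁵ ∣ c₄`, `ord c₆ = 7`, `ord Δ = 11`
(row `(≥5, 7, 11)`, `f = 5`) — the exit-II data shifted by `(2, 3, 6)`.
[cite: Silverman1994, IV.9.4 Step 8 and Table 4.1] [cite: Rizzo2003, Table II (p. 4), rows IV*] -/
theorem exitIVstar_values (h2 : IsUnit (2 : R)) (h3 : Irreducible (3 : R))
    (W : WeierstrassCurve R) (ha₁ : W.a₁ ∈ maximalIdeal R) (ha₂ : W.a₂ ∈ maximalIdeal R ^ 2)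
    (ha₃ : W.a₃ ∈ maximalIdeal R ^ 2) (ha₄ : W.a₄ ∈ maximalIdeal R ^ 3)
    (ha₆ : W.a₆ ∈ maximalIdeal R ^ 4) (h8t : distinctRootCount (quadraticStep8 W) = 2) :
    ∃ B₂ B₄ B₆ : R, W.b₂ = 3 ^ 2 * B₂ ∧ W.b₄ = 3 ^ 3 * B₄ ∧ W.b₆ = 3 ^ 4 * B₆ ∧ IsUnit B₆ ∧
      ((IsUnit B₂ ∧ IsUnit B₄ ∧ (3 : R) ^ 4 ∣ W.c₄ ∧ (addVal R W.c₆).toNat = 6 ∧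
          (addVal R W.Δ).toNat = 9) ∨
        (¬ IsUnit B₂ ∧ IsUnit B₄ ∧ (addVal R W.c₄).toNat = 4 ∧ (addVal R W.c₆).toNat = 7 ∧
          (addVal R W.Δ).toNat = 9) ∨
        (IsUnit B₂ ∧ ¬ IsUnit B₄ ∧ (addVal R W.c₄).toNat = 4 ∧ (addVal R W.c₆).toNat = 6 ∧
          (addVal R W.Δ).toNat = 10) ∨
        (¬ IsUnit B₂ ∧ ¬ IsUnit B₄ ∧ (3 : R) ^ 5 ∣ W.c₄ ∧ (addVal R W.c₆).toNat = 7 ∧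
          (addVal R W.Δ).toNat = 11)) := by
  set ϖ := uniformizer R with hϖdef
  have hϖ : Irreducible ϖ := irreducible_uniformizer
  -- the test, decoded on the `ϖ`-parametrisation
  obtain ⟨γ', hγ'⟩ := (mem_maximalIdeal_pow_iff_dvd_of_irreducible hϖ _ _).mp ha₃
  obtain ⟨r', hr'⟩ := (mem_maximalIdeal_pow_iff_dvd_of_irreducible hϖ _ _).mp ha₆
  have hX : IsUnit (γ' ^ 2 + 4 * r') := by
    rw [quadraticStep8_eq hγ' hr', distinctRootCount_monicQuadratic_eq_two_iff h2, ← map_pow,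
      ← map_ofNat (residue R), ← map_mul, ← map_add, ← isUnit_iff_residue_ne_zero] at h8t
    exact h8t
  have hb₆ϖ : W.b₆ = ϖ ^ 4 * (γ' ^ 2 + 4 * r') := b₆_step8 W ϖ hγ' hr'
  -- the `3`-parametrisation
  obtain ⟨α, hα⟩ := (mem_iff_three_dvd h3 _).mp ha₁
  obtain ⟨p, hp⟩ := (mem_pow_iff_three_pow_dvd h3 _ _).mp ha₂
  obtain ⟨γ, hγ⟩ := (mem_pow_iff_three_pow_dvd h3 _ _).mp ha₃
  obtain ⟨q, hq⟩ := (mem_pow_iff_three_pow_dvd h3 _ _).mp ha₄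
  obtain ⟨r, hr⟩ := (mem_pow_iff_three_pow_dvd h3 _ _).mp ha₆
  have hα' : W.a₁ = 3 * α := by rw [hα]
  have hb₂ := b₂_step8 W 3 hα' hp
  have hb₄ := b₄_step8 W 3 hα' hγ hq
  have hb₆ := b₆_step8 W 3 hγ hr
  set B₂ : R := 4 * p + α ^ 2 with hB₂def
  set B₄ : R := 2 * q + α * γ with hB₄def
  set B₆ : R := γ ^ 2 + 4 * r with hB₆def
  have hB₆ : IsUnit B₆ := by
    rw [isUnit_iff_not_dvd h3]
    intro hd
    have h5 : W.b₆ ∈ maximalIdeal R ^ 5 :=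
      (mem_pow_iff_three_pow_dvd h3 _ 5).mpr (by rw [hb₆, pow_succ]; exact mul_dvd_mul_left _ hd)
    have h5' := (mem_maximalIdeal_pow_iff_dvd_of_irreducible hϖ _ 5).mp h5
    rw [hb₆ϖ, pow_succ, mul_dvd_mul_iff_left (pow_ne_zero 4 hϖ.ne_zero)] at h5'
    exact (isUnit_iff_not_dvd hϖ _).mp hX h5'
  have h4 : IsUnit (4 : R) := isUnit_four h2
  have h8 : IsUnit (8 : R) := isUnit_eight' h2
  have h32 : IsUnit (32 : R) := isUnit_32 h2
  have hc₄ := c₄_of_b_nine W hb₂ hb₄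
  have hc₆ := c₆_of_b_nine W hb₂ hb₄ hb₆
  have hΔ := four_Δ_of_b_nine W hb₂ hb₄ hb₆
  refine ⟨B₂, B₄, B₆, hb₂, hb₄, hb₆, hB₆, ?_⟩
  by_cases hB₄ : IsUnit B₄
  · by_cases hB₂ : IsUnit B₂
    · -- row (≥4, 6, 9)
      refine Or.inl ⟨hB₂, hB₄, ⟨B₂ ^ 2 - 8 * B₄, hc₄⟩, ?_, ?_⟩
      · have e : 1 * W.c₆ = 3 ^ 6 * (-B₂ ^ 3 + 3 * (4 * B₂ * B₄ - 8 * B₆)) := by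
          rw [hc₆]; ring
        exact addVal_toNat_eq_of_eq_add h3 isUnit_one (hB₂.pow 3).neg e
      · have e : 4 * W.Δ = 3 ^ 9 * (-32 * B₄ ^ 3 +
            3 * (-B₂ ^ 3 * B₆ + B₂ ^ 2 * B₄ ^ 2 - 12 * B₆ ^ 2 + 12 * B₂ * B₄ * B₆)) := by
          rw [hΔ]
        exact addVal_toNat_eq_of_eq_add h3 h4 (h32.neg.mul (hB₄.pow 3)) e
    · -- row (4, 7, 9)
      obtain ⟨B₂', hB₂'⟩ := (not_isUnit_iff_dvd h3 _).mp hB₂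
      refine Or.inr (Or.inl ⟨hB₂, hB₄, ?_, ?_, ?_⟩)
      · have e : 1 * W.c₄ = 3 ^ 4 * (-(8 * B₄) + 3 * (3 * B₂' ^ 2)) := by
          rw [hc₄, hB₂']; ring
        exact addVal_toNat_eq_of_eq_add h3 isUnit_one (h8.mul hB₄).neg e
      · have e : 1 * W.c₆ = 3 ^ 7 * (-(8 * B₆) + 3 * (-(3 * B₂' ^ 3) + 4 * B₂' * B₄)) := by
          rw [hc₆, hB₂']; ring
        exact addVal_toNat_eq_of_eq_add h3 isUnit_one (h8.mul hB₆).neg e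
      · have e : 4 * W.Δ = 3 ^ 9 * (-32 * B₄ ^ 3 +
            3 * (-(27 * B₂' ^ 3) * B₆ + 9 * B₂' ^ 2 * B₄ ^ 2 - 12 * B₆ ^ 2 +
              36 * B₂' * B₄ * B₆)) := by
          rw [hΔ, hB₂']; ring
        exact addVal_toNat_eq_of_eq_add h3 h4 (h32.neg.mul (hB₄.pow 3)) e
  · obtain ⟨B₄', hB₄'⟩ := (not_isUnit_iff_dvd h3 _).mp hB₄
    by_cases hB₂ : IsUnit B₂
    · -- row (4, 6, 10)
      refine Or.inr (Or.inr (Or.inl ⟨hB₂, hB₄, ?_, ?_, ?_⟩))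
      · have e : 1 * W.c₄ = 3 ^ 4 * (B₂ ^ 2 + 3 * (-(8 * B₄'))) := by
          rw [hc₄, hB₄']; ring
        exact addVal_toNat_eq_of_eq_add h3 isUnit_one (hB₂.pow 2) e
      · have e : 1 * W.c₆ = 3 ^ 6 * (-B₂ ^ 3 + 3 * (12 * B₂ * B₄' - 8 * B₆)) := by
          rw [hc₆, hB₄']; ring
        exact addVal_toNat_eq_of_eq_add h3 isUnit_one (hB₂.pow 3).neg e
      · have e : 4 * W.Δ = 3 ^ 10 * (-B₂ ^ 3 * B₆ +
            3 * (-(96 * B₄' ^ 3) + 3 * B₂ ^ 2 * B₄' ^ 2 - 4 * B₆ ^ 2 + 12 * B₂ * B₄' * B₆)) := by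
          rw [hΔ, hB₄']; ring
        exact addVal_toNat_eq_of_eq_add h3 h4 ((hB₂.pow 3).neg.mul hB₆) e
    · -- row (≥5, 7, 11)
      obtain ⟨B₂', hB₂'⟩ := (not_isUnit_iff_dvd h3 _).mp hB₂
      refine Or.inr (Or.inr (Or.inr ⟨hB₂, hB₄, ⟨3 * B₂' ^ 2 - 8 * B₄', ?_⟩, ?_, ?_⟩))
      · rw [hc₄, hB₂', hB₄']; ring
      · have e : 1 * W.c₆ = 3 ^ 7 * (-(8 * B₆) + 3 * (-(3 * B₂' ^ 3) + 12 * B₂' * B₄')) := by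
          rw [hc₆, hB₂', hB₄']; ring
        exact addVal_toNat_eq_of_eq_add h3 isUnit_one (h8.mul hB₆).neg e
      · have e : 4 * W.Δ = 3 ^ 11 * (-(4 * B₆ ^ 2) +
            3 * (-(3 * B₂' ^ 3) * B₆ + 9 * B₂' ^ 2 * B₄' ^ 2 - 32 * B₄' ^ 3 +
              12 * B₂' * B₄' * B₆)) := by
          rw [hΔ, hB₂', hB₄']; ring
        exact addVal_toNat_eq_of_eq_add h3 h4 ((h4.mul (hB₆.pow 2))).neg e

end TateAlgorithm

end Literature.NumberTheory.DiophantineGeometry
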